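/-
Copyright (c) 2026 the pub-hodgecm-mathlib formalisation cell (harness21).  Prover seat hodgecm-mathlib-K2Liu-p12 (g2): Track B «K2-LIT»,
#184♮ = hLiu418 = stmt-HodgeConjecture-24832; Road Φ of socket #41, organ Φ4-EXACT (LEAD F0P6-plan ruling «M-157p»), file E2b.
-/
import Summits.HodgeConjecture.HodgeConjecture.Theorems.K2LiuSkewPairingNondegeneracy   -- ★ E2a: skew algebra (projector, duals, adjugates)
import HarnessLib

/-!
# Crux `HLiu418`, Road Φ of socket #41, organ Φ4-EXACT — FILE E2b: PERFECTNESS OF THE TRACE PAIRING AND NON-TRIVIALITY OF THE WHITTAKER CHARACTER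

Cell `hodgecm-mathlib`, crux item hLiu418 = `stmt-HodgeConjecture-24832`, route of record `HCCMUnconditional`; squad K2 ∕ K2Liu, road `K2_Liu`,
socket #41 `sig_K2LiuSiegelEisensteinContinuation`, Road Φ, organ Φ4-EXACT (ruling M-157p; method memo `K2/K2Liu-p12/g2/CENSUS-PHI4-EXACT-Method.K2Liu-p12-g2.md`
§1 (c)).  THEOREMS ONLY (no `def`, no `instance`, no `notation`, no named-fact hypothesis, no `sorry`); lane `--supports stmt-HodgeConjecture-24832`
(count-neutral helper; closes no socket by itself).

THE OBJECTS (as in ★ E2a).  `S` the `T`-skew lattice in `M₂(E ⊗ F_v)`, `τ` the trace-type functional (`ι(τ r) = r + σ r`), `β` a UNIMODULAR `T`-skew Fourier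
index (`β β⁻ = 1`, `β, β⁻ ∈ ball 0`), `ψ_v` of conductor exponent `0`, `ε` an anti-invariant unit with `|2ε|_w = |2|_w = 1` (UNRAMIFIED good place),
`χ_β(Z) = ψ_v(−τ tr(β Z))`.
* §1 **PERFECTNESS (P)**: `t ∈ S` and `τ tr(tY) ∈ 𝔭_v` for all `Y ∈ S ∩ ball 0` ⇒ `t ∈ ball 1`.  (★ E2a projector extends the hypothesis to every
  integral `Y`; ★ F3c-2 `mball_of_forall_coeff_mem` — coordinate recovery through `β⁻` — concludes.)
* §2 ELIMINATION: from «`τ tr(WY) ∈ 𝔭 ⇒ τ tr(βY) ∈ 𝔭` on `S ∩ ball 0`» to some `λ ∈ 𝒪_v` with «`τ tr((β − ι(λ)W)Y) ∈ 𝔭` on `S ∩ ball 0`».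
* §3 **NON-TRIVIALITY OF `χ_β`** (`n = 2`): (N1) some `Z ∈ S ∩ ball(−1)` has `χ_β(Z) ≠ 1`; (N2) for `k ≥ 2` and `X ∈ S ∩ ball(−k)` with
  `|det X|_w ≤ |ϖ|_w^{−k−1}`, some `Z ∈ S ∩ ball(−1)` with `tr(adj X·Z) ∈ ball(−k)` has `χ_β(Z) ≠ 1` — else §2 + §1 force `β ≡ ι(λ)ϖ^k adj X (mod ball 1)`,
  whence `|det β|_w < 1`, contradicting unimodularity.  (N2) is exactly what kills the fibres of the det level set `D(k) ∩ B(−k)` in E2c.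

## References
* [Shimura1997] G. Shimura, *Euler Products and Eisenstein Series*, CBMS 93 (1997), §13.5–13.6, §18.
* [KudlaRallis1994] S. Kudla, S. Rallis, Ann. of Math. 140 (1994), §2.   * [Casselman1980] W. Casselman, Compositio Math. 40 (1980), §3.
* [Tate1950] J. Tate, thesis (1950), §2.2–2.5.
-/

set_option autoImplicit false
-- the mandated namespace repeats the single-problem summit's segment (`HodgeConjecture.HodgeConjecture`)
set_option linter.dupNamespace false

noncomputable section

open scoped Matrix
open NumberField IsDedekindDomain Matrix
open Literature.NumberTheory.Automorphic Literature.NumberTheory.Automorphic.UnitaryGroup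
open Literature.NumberTheory.GelbartRogawski1991.UnitaryDualPair.LocalSplitting
open Summit.HodgeConjecture.HodgeConjecture.Cruxes.HLiu418.K2LiuLocalRingValuationBalls
open Summit.HodgeConjecture.HodgeConjecture.Cruxes.HLiu418.K2LiuWhittakerCharacterMoves
open Summit.HodgeConjecture.HodgeConjecture.Cruxes.HLiu418.K2LiuWhittakerContentProfile
open Summit.HodgeConjecture.HodgeConjecture.Cruxes.HLiu418.K2LiuWhittakerContentStrata
open Summit.HodgeConjecture.HodgeConjecture.Cruxes.HLiu418.K2LiuSkewPairingNondegeneracy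

namespace Summit.HodgeConjecture.HodgeConjecture.Cruxes.HLiu418.K2LiuSkewPairingPerfect

variable (F : Type) [Field F] [NumberField F] (E : Type) [Field E] [NumberField E] [Algebra F E]
  [Algebra.IsQuadraticExtension F E] (c : E ≃ₐ[F] E) {δ : E} (hcδ : c δ = -δ) (hδ : δ ≠ 0)
  (v : HeightOneSpectrum (𝓞 F)) {π : v.adicCompletion F} (hπ : Valued.v π = WithZero.exp (-1 : ℤ))
  {n : ℕ} {T₀ : Matrix (Fin n) (Fin n) F} (hT₀ : T₀.IsSymm) (hT₀d : IsUnit T₀.det)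
  {τ : LocalRing E v → v.adicCompletion F}

/-! ## §0 Small letters: `τ` is `𝒪_v`-linear, membership in `𝔭_v^a` -/

omit [Algebra.IsQuadraticExtension F E] in
/-- `τ(r − s) = τ r − τ s`. [folklore] -/
theorem tau_sub (hτadd : ∀ r s, τ (r + s) = τ r + τ s) (r s : LocalRing E v) : τ (r - s) = τ r - τ s :=
  eq_sub_of_add_eq (by rw [← hτadd, sub_add_cancel])

omit [Algebra.IsQuadraticExtension F E] in
/-- `τ tr((β − ι(λ)W) Y) = τ tr(βY) − λ·τ tr(WY)`. [folklore] -/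
theorem tau_trace_sub_smul_mul (hτadd : ∀ r s, τ (r + s) = τ r + τ s)
    (hτs : ∀ (z : v.adicCompletion F) (r : LocalRing E v), τ (toLocalRing E v z * r) = z * τ r)
    (lam : v.adicCompletion F) (β W Y : Matrix (Fin n) (Fin n) (LocalRing E v)) :
    τ (Matrix.trace ((β - toLocalRing E v lam • W) * Y)) = τ (Matrix.trace (β * Y)) - lam * τ (Matrix.trace (W * Y)) := by
  rw [Matrix.sub_mul, Matrix.trace_sub, tau_sub F E v hτadd, Matrix.smul_mul, Matrix.trace_smul, smul_eq_mul, hτs]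

omit [Algebra.IsQuadraticExtension F E] in
/-- `τ tr(W (ι(z) • Y)) = z · τ tr(W Y)`. [folklore] -/
theorem tau_trace_mul_smul (hτs : ∀ (z : v.adicCompletion F) (r : LocalRing E v), τ (toLocalRing E v z * r) = z * τ r)
    (z : v.adicCompletion F) (W Y : Matrix (Fin n) (Fin n) (LocalRing E v)) :
    τ (Matrix.trace (W * (toLocalRing E v z • Y))) = z * τ (Matrix.trace (W * Y)) := by
  rw [Matrix.mul_smul, Matrix.trace_smul, smul_eq_mul, hτs]

include hπ in
omit [NumberField E] in
/-- `x ∈ 𝔭_v^a ↔ |x|_v ≤ |ϖ|_v^a`. [folklore] -/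
theorem mem_primePowBall_iff_le_zpow (a : ℤ) (x : v.adicCompletion F) :
    x ∈ primePowBall (v.adicCompletion F) a ↔ Valued.v x ≤ Valued.v π ^ a := by
  rw [mem_primePowBall_adicCompletion_iff, hπ, ← WithZero.exp_zsmul, smul_eq_mul, mul_neg_one]

/-! ## §1 Perfectness of the trace pairing on `S ∩ ball 0` -/

include hcδ hδ hπ hT₀ hT₀d in
/-- **PERFECTNESS (P).**  At an unramified good place (`|2|_v = 1`, `T, T⁻¹` integral, an anti-invariant unit `ε` with `|2ε|_w = 1`), given ONE unimodular
`T`-skew `β` (`ββ⁻ = 1`, `β, β⁻` integral): if `t ∈ S` pairs every `Y ∈ S ∩ ball 0` into `𝔭_v` (`τ tr(tY) ∈ 𝔭_v`), then `t ∈ ball 1`.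
[cite: Shimura1997, §13.5–13.6] [cite: KudlaRallis1994, §2] -/
theorem mball_one_of_forall_tau_trace_mem
    (hτ : ∀ r, toLocalRing E v (τ r) = r + conjLocal E c v r) (hτadd : ∀ r s, τ (r + s) = τ r + τ s)
    (h2F : Valued.v (2 : v.adicCompletion F) = 1)
    (hTb : ∀ i j (w : PlacesOver E v), Valued.v (gramS F E v n T₀ i j w) ≤ Valued.v (toPlace v w π) ^ (0 : ℤ))
    (hTib : ∀ i j (w : PlacesOver E v), Valued.v ((gramS F E v n T₀)⁻¹ i j w) ≤ Valued.v (toPlace v w π) ^ (0 : ℤ))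
    {ε : LocalRing E v} (hεσ : conjLocal E c v ε = -ε) (hεint : ∀ w : PlacesOver E v, Valued.v (ε w) ≤ 1)
    (hε : ∀ w : PlacesOver E v, Valued.v (toPlace v w π) ^ (0 : ℤ) ≤ Valued.v ((2 * ε) w))
    (h2 : ∀ w : PlacesOver E v, Valued.v (toPlace v w π) ^ (0 : ℤ) ≤ Valued.v ((2 : LocalRing E v) w))
    {β βinv : Matrix (Fin n) (Fin n) (LocalRing E v)} (hβs : (β.map (conjLocal E c v))ᵀ * gramS F E v n T₀ + gramS F E v n T₀ * β = 0)
    (hββ : β * βinv = 1) (hβ0 : ∀ i j (w : PlacesOver E v), Valued.v (β i j w) ≤ Valued.v (toPlace v w π) ^ (0 : ℤ))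
    (hβinv0 : ∀ i j (w : PlacesOver E v), Valued.v (βinv i j w) ≤ Valued.v (toPlace v w π) ^ (0 : ℤ))
    {t : Matrix (Fin n) (Fin n) (LocalRing E v)} (ht : (t.map (conjLocal E c v))ᵀ * gramS F E v n T₀ + gramS F E v n T₀ * t = 0)
    (h : ∀ Y : Matrix (Fin n) (Fin n) (LocalRing E v), (Y.map (conjLocal E c v))ᵀ * gramS F E v n T₀ + gramS F E v n T₀ * Y = 0 →
      (∀ i j (w : PlacesOver E v), Valued.v (Y i j w) ≤ Valued.v (toPlace v w π) ^ (0 : ℤ)) →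
        τ (Matrix.trace (t * Y)) ∈ primePowBall (v.adicCompletion F) 1) :
    ∀ i j (w : PlacesOver E v), Valued.v (t i j w) ≤ Valued.v (toPlace v w π) ^ (1 : ℤ) := by
  have hT : IsUnit (gramS F E v n T₀).det := isUnit_det_gramS' F E v n hT₀d
  have hTt : (gramS F E v n T₀)ᵀ = gramS F E v n T₀ := gramS_transpose F E v n hT₀
  have h20 : (2 : v.adicCompletion F) ≠ 0 := fun h0 => by rw [h0, map_zero] at h2F; exact zero_ne_one h2F
  -- step 1: the hypothesis extends to every integral `Y` (projector `Y ↦ Y + Y°`)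
  have hall : ∀ Y : Matrix (Fin n) (Fin n) (LocalRing E v),
      (∀ i j (w : PlacesOver E v), Valued.v (Y i j w) ≤ Valued.v (toPlace v w π) ^ (0 : ℤ)) →
        τ (Matrix.trace (t * Y)) ∈ primePowBall (v.adicCompletion F) 1 := by
    intro Y hY
    have hdual0 : ∀ i j (w : PlacesOver E v),
        Valued.v ((Y + -((gramS F E v n T₀)⁻¹ * (Y.map (conjLocal E c v))ᵀ * gramS F E v n T₀)) i j w) ≤ Valued.v (toPlace v w π) ^ (0 : ℤ) := by
      have h1 := mball_mul F E v hπ (mball_mul F E v hπ hTib (mball_conjTranspose F E c v hY)) hTb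
      rw [show (0 : ℤ) + 0 + 0 = 0 by norm_num] at h1
      exact mball_add F E v hY fun i j w => by rw [Matrix.neg_apply, Pi.neg_apply, Valuation.map_neg]; exact h1 i j w
    have h2x := h _ (add_dual_skew F E c hcδ hδ v hT₀ hT₀d Y) hdual0
    rw [tau_trace_mul_add_dual F E c hcδ hδ v hT₀ hT₀d hτ hτadd ht Y, ← two_mul] at h2x
    have h2inv : (2 : v.adicCompletion F)⁻¹ ∈ primePowBall (v.adicCompletion F) 0 := by
      rw [mem_primePowBall_adicCompletion_iff, map_inv₀, h2F, inv_one, neg_zero, WithZero.exp_zero]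
    have h3 := mul_mem_primePowBall h2inv h2x
    rwa [zero_add, inv_mul_cancel_left₀ h20] at h3
  -- step 2: ★ coordinate recovery through `β⁻`
  have hrec := mball_of_forall_coeff_mem F E c v hπ hcδ hδ hτ hτadd hT hTt hεσ hεint (cε := 0) (c₂ := 0) (b' := 0) (μ := 1) hε h2 hββ
    (by simpa only [neg_zero] using hβinv0) hβs ht (fun a b e he => by
      rw [tau_trace_linear_term F E c v hcδ hδ hτ hτadd hT hTt hβs ht]
      have hs : ∀ i j (w : PlacesOver E v), Valued.v ((Matrix.single a b e) i j w) ≤ Valued.v (toPlace v w π) ^ (0 : ℤ) := by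
        intro i j w
        rw [zpow_zero, Matrix.single_apply]
        split_ifs
        · simp only [Set.mem_insert_iff, Set.mem_singleton_iff] at he
          rcases he with rfl | rfl
          · rw [Pi.one_apply, map_one]
          · exact hεint w
        · rw [Pi.zero_apply, map_zero]; exact zero_le
      have hu : ∀ i j (w : PlacesOver E v), Valued.v ((β * Matrix.single a b e) i j w) ≤ Valued.v (toPlace v w π) ^ (0 : ℤ) := by
        have h1 := mball_mul F E v hπ hβ0 hs
        rwa [add_zero] at h1
      have hY := hall _ hu
      rw [← Matrix.mul_assoc, Matrix.trace_mul_comm]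
      exact add_mem_primePowBall hY hY)
  intro i j w
  have hij := hrec i j w
  rwa [show (1 : ℤ) - 0 - 0 - 0 = 1 by norm_num] at hij

/-! ## §2 Elimination: one scalar `λ` -/

include hπ in
omit [Algebra.IsQuadraticExtension F E] in
/-- **ELIMINATION.**  If, on `S ∩ ball 0`, `τ tr(WY) ∈ 𝔭_v` implies `τ tr(βY) ∈ 𝔭_v` (`W, β` integral), then for some `λ ∈ 𝒪_v`:
`τ tr((β − ι(λ)W) Y) ∈ 𝔭_v` for every `Y ∈ S ∩ ball 0` (no quotient spaces: pick `Y₀` with `τ tr(WY₀)` a unit, `λ = τ tr(βY₀)/τ tr(WY₀)`).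
[cite: Shimura1997, §13.6] -/
theorem exists_scalar_tau_trace_sub_mem
    (hτ : ∀ r, toLocalRing E v (τ r) = r + conjLocal E c v r) (hτadd : ∀ r s, τ (r + s) = τ r + τ s)
    (hτs : ∀ (z : v.adicCompletion F) (r : LocalRing E v), τ (toLocalRing E v z * r) = z * τ r)
    {W β : Matrix (Fin n) (Fin n) (LocalRing E v)}
    (hW0 : ∀ i j (w : PlacesOver E v), Valued.v (W i j w) ≤ Valued.v (toPlace v w π) ^ (0 : ℤ))
    (hβ0 : ∀ i j (w : PlacesOver E v), Valued.v (β i j w) ≤ Valued.v (toPlace v w π) ^ (0 : ℤ))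
    (H : ∀ Y : Matrix (Fin n) (Fin n) (LocalRing E v), (Y.map (conjLocal E c v))ᵀ * gramS F E v n T₀ + gramS F E v n T₀ * Y = 0 →
      (∀ i j (w : PlacesOver E v), Valued.v (Y i j w) ≤ Valued.v (toPlace v w π) ^ (0 : ℤ)) →
        τ (Matrix.trace (W * Y)) ∈ primePowBall (v.adicCompletion F) 1 → τ (Matrix.trace (β * Y)) ∈ primePowBall (v.adicCompletion F) 1) :
    ∃ lam : v.adicCompletion F, Valued.v lam ≤ 1 ∧
      ∀ Y : Matrix (Fin n) (Fin n) (LocalRing E v), (Y.map (conjLocal E c v))ᵀ * gramS F E v n T₀ + gramS F E v n T₀ * Y = 0 →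
        (∀ i j (w : PlacesOver E v), Valued.v (Y i j w) ≤ Valued.v (toPlace v w π) ^ (0 : ℤ)) →
          τ (Matrix.trace ((β - toLocalRing E v lam • W) * Y)) ∈ primePowBall (v.adicCompletion F) 1 := by
  -- integral pairings lie in `𝔭^0`
  have hint : ∀ (A Y : Matrix (Fin n) (Fin n) (LocalRing E v)), (∀ i j (w : PlacesOver E v), Valued.v (A i j w) ≤ Valued.v (toPlace v w π) ^ (0 : ℤ)) →
      (∀ i j (w : PlacesOver E v), Valued.v (Y i j w) ≤ Valued.v (toPlace v w π) ^ (0 : ℤ)) →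
        τ (Matrix.trace (A * Y)) ∈ primePowBall (v.adicCompletion F) 0 := fun A Y hA hY => by
    have h1 := mball_mul F E v hπ hA hY
    rw [add_zero] at h1
    exact tau_mem_primePowBall F E c v hπ hτ (ball_trace F E v h1)
  by_cases hc : ∀ Y : Matrix (Fin n) (Fin n) (LocalRing E v), (Y.map (conjLocal E c v))ᵀ * gramS F E v n T₀ + gramS F E v n T₀ * Y = 0 →
      (∀ i j (w : PlacesOver E v), Valued.v (Y i j w) ≤ Valued.v (toPlace v w π) ^ (0 : ℤ)) →
        τ (Matrix.trace (W * Y)) ∈ primePowBall (v.adicCompletion F) 1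
  · refine ⟨0, by rw [map_zero]; exact zero_le, fun Y hYs hYb => ?_⟩
    rw [tau_trace_sub_smul_mul F E v hτadd hτs, zero_mul, sub_zero]
    exact H Y hYs hYb (hc Y hYs hYb)
  · push Not at hc
    obtain ⟨Y₀, hY₀s, hY₀b, hu⟩ := hc
    set u₀ := τ (Matrix.trace (W * Y₀)) with hu₀
    have hu0 : u₀ ∈ primePowBall (v.adicCompletion F) 0 := hint W Y₀ hW0 hY₀b
    have hvu : Valued.v u₀ = 1 := by
      rw [mem_primePowBall_iff_le_zpow F v hπ] at hu0 hu
      have h1 := valued_eq_zpow_of_le_of_not_le hπ 0 hu0 (by rwa [zero_add])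
      rw [h1, zpow_zero]
    have hu0ne : u₀ ≠ 0 := fun h0 => by rw [h0, map_zero] at hvu; exact zero_ne_one hvu
    have huinv : u₀⁻¹ ∈ primePowBall (v.adicCompletion F) 0 := by
      rw [mem_primePowBall_adicCompletion_iff, map_inv₀, hvu, inv_one, neg_zero, WithZero.exp_zero]
    refine ⟨τ (Matrix.trace (β * Y₀)) * u₀⁻¹, ?_, fun Y hYs hYb => ?_⟩
    · have hb := hint β Y₀ hβ0 hY₀b
      rw [mem_primePowBall_adicCompletion_iff, neg_zero, WithZero.exp_zero] at hb
      rw [map_mul, map_inv₀, hvu, inv_one, mul_one]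
      exact hb
    · set a := τ (Matrix.trace (W * Y)) with ha
      have ha0 : a ∈ primePowBall (v.adicCompletion F) 0 := hint W Y hW0 hYb
      -- the test element `Y'' = ι(u₀)·Y − ι(a)·Y₀ ∈ S ∩ ball 0` pairs with `W` to `0`
      have hY''s := sub_skew F E c v (smul_skew F E c v u₀ hYs) (smul_skew F E c v a hY₀s)
      have hY''b : ∀ i j (w : PlacesOver E v), Valued.v ((toLocalRing E v u₀ • Y - toLocalRing E v a • Y₀) i j w) ≤ Valued.v (toPlace v w π) ^ (0 : ℤ) := by
        have h1 := mball_smul F E v hπ hu0 hYb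
        have h2 := mball_smul F E v hπ ha0 hY₀b
        rw [zero_add] at h1 h2
        rw [sub_eq_add_neg]
        exact mball_add F E v h1 fun i j w => by rw [Matrix.neg_apply, Pi.neg_apply, Valuation.map_neg]; exact h2 i j w
      have hW'' : τ (Matrix.trace (W * (toLocalRing E v u₀ • Y - toLocalRing E v a • Y₀))) ∈ primePowBall (v.adicCompletion F) 1 := by
        rw [Matrix.mul_sub, Matrix.trace_sub, tau_sub F E v hτadd, tau_trace_mul_smul F E v hτs, tau_trace_mul_smul F E v hτs, ← ha, ← hu₀,
          mul_comm u₀ a, sub_self]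
        exact zero_mem_primePowBall 1
      have hβ'' := H _ hY''s hY''b hW''
      rw [Matrix.mul_sub, Matrix.trace_sub, tau_sub F E v hτadd, tau_trace_mul_smul F E v hτs, tau_trace_mul_smul F E v hτs] at hβ''
      rw [tau_trace_sub_smul_mul F E v hτadd hτs, ← ha]
      have key : τ (Matrix.trace (β * Y)) - τ (Matrix.trace (β * Y₀)) * u₀⁻¹ * a =
          u₀⁻¹ * (u₀ * τ (Matrix.trace (β * Y)) - a * τ (Matrix.trace (β * Y₀))) := by
        field_simp
      rw [key]
      have h3 := mul_mem_primePowBall huinv hβ''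
      rwa [zero_add] at h3

/-! ## §3 Non-triviality of the Whittaker character (`n = 2`) -/

section RankTwo

variable {T₂ : Matrix (Fin 2) (Fin 2) F}
  (hT₂ : T₂.IsSymm) (hT₂d : IsUnit T₂.det)

include hπ in
omit [Algebra.IsQuadraticExtension F E] in
/-- **(N1)**: for a unimodular `T`-skew `β` (`ββ⁻ = 1`, `β⁻` integral), `ψ_v` of conductor exponent `0` and `|2|_v = 1`, some `Z ∈ S ∩ ball(−1)` has
`ψ_v(−τ tr(βZ)) ≠ 1` (`Z = ι(−x)·β⁻`, `τ tr(ββ⁻) = 4`). [cite: Tate1950, §2.5] [cite: Casselman1980, §3] -/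
theorem exists_skew_mball_addChar_ne_one
    (hτ : ∀ r, toLocalRing E v (τ r) = r + conjLocal E c v r)
    (hτs : ∀ (z : v.adicCompletion F) (r : LocalRing E v), τ (toLocalRing E v z * r) = z * τ r)
    (h2F : Valued.v (2 : v.adicCompletion F) = 1) {ψ : AddChar (v.adicCompletion F) Circle} (hdψ : ψ.HasConductorExp 0)
    {β βinv : Matrix (Fin 2) (Fin 2) (LocalRing E v)} (hβs : (β.map (conjLocal E c v))ᵀ * gramS F E v 2 T₂ + gramS F E v 2 T₂ * β = 0)
    (hββ : β * βinv = 1) (hβinv0 : ∀ i j (w : PlacesOver E v), Valued.v (βinv i j w) ≤ Valued.v (toPlace v w π) ^ (0 : ℤ)) :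
    ∃ Z : Matrix (Fin 2) (Fin 2) (LocalRing E v), (Z.map (conjLocal E c v))ᵀ * gramS F E v 2 T₂ + gramS F E v 2 T₂ * Z = 0 ∧
      (∀ i j (w : PlacesOver E v), Valued.v (Z i j w) ≤ Valued.v (toPlace v w π) ^ (-1 : ℤ)) ∧
      ψ (-τ (Matrix.trace (β * Z))) ≠ 1 := by
  -- `τ tr(β β⁻) = τ(2) = 4`, a unit
  have hτ1 : τ 1 = 2 := toLocalRing_injective E v (by rw [hτ, map_one, map_ofNat]; norm_num)
  have htr : τ (Matrix.trace (β * βinv)) = 4 := by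
    rw [hββ, Matrix.trace_one, Fintype.card_fin, show ((2 : ℕ) : LocalRing E v) = toLocalRing E v 2 * 1 by rw [map_ofNat, mul_one]; rfl,
      hτs, hτ1]
    norm_num
  have h4 : (4 : v.adicCompletion F) ∉ primePowBall (v.adicCompletion F) (0 - -1) := by
    rw [mem_primePowBall_adicCompletion_iff, show (4 : v.adicCompletion F) = 2 * 2 by norm_num, map_mul, h2F, mul_one, not_le]
    rw [show (0 : ℤ) - -1 = 1 by norm_num, ← WithZero.exp_zero, WithZero.exp_lt_exp]; norm_num
  obtain ⟨x₀, hx₀, hne⟩ := exists_mem_primePowBall_addChar_mul_ne_one hdψ h4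
  refine ⟨toLocalRing E v (-x₀) • βinv, smul_skew F E c v (-x₀) (inv_skew F E c v hβs hββ), ?_, ?_⟩
  · have h1 := mball_smul F E v hπ (neg_mem_primePowBall hx₀) hβinv0
    rwa [add_zero] at h1
  · rw [tau_trace_mul_smul F E v hτs, htr, neg_mul, neg_neg]
    exact hne

include hcδ hδ hπ hT₂ hT₂d in
/-- **(N2) — NON-TRIVIALITY ON THE FIBRES OF THE DET LEVEL SET.**  `k ≥ 2`, `X ∈ S ∩ ball(−k)` with `|det X|_w ≤ |ϖ|_w^{−k−1}` at every `w`, `β` unimodular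
`T`-skew, `ψ_v` of conductor exponent `0`, good unramified place: some `Z ∈ S ∩ ball(−1)` with `tr(adj X · Z) ∈ ball(−k)` has `ψ_v(−τ tr(βZ)) ≠ 1`.
Otherwise every `Y ∈ S ∩ ball 0` with `τ tr(WY) ∈ 𝔭_v`, `W := ι(ϖ^k)·adj X`, has `τ tr(βY) ∈ 𝔭_v` (test `Z = ι(−x)·Y`, `x ∈ 𝔭_v⁻¹`); §2 and §1 then give
`β − ι(λ)W ∈ ball 1`, and `det β = λ²ϖ^{2k} det X + tr(adj(λW)·t) + det t ∈ 𝔭_v` — impossible for `det β · det β⁻ = 1`.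
[cite: Shimura1997, §13.6] [cite: KudlaRallis1994, §2] [cite: Casselman1980, §3] -/
theorem exists_fibre_addChar_ne_one
    (hτ : ∀ r, toLocalRing E v (τ r) = r + conjLocal E c v r) (hτadd : ∀ r s, τ (r + s) = τ r + τ s)
    (hτs : ∀ (z : v.adicCompletion F) (r : LocalRing E v), τ (toLocalRing E v z * r) = z * τ r)
    (h2F : Valued.v (2 : v.adicCompletion F) = 1)
    (hTb : ∀ i j (w : PlacesOver E v), Valued.v (gramS F E v 2 T₂ i j w) ≤ Valued.v (toPlace v w π) ^ (0 : ℤ))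
    (hTib : ∀ i j (w : PlacesOver E v), Valued.v ((gramS F E v 2 T₂)⁻¹ i j w) ≤ Valued.v (toPlace v w π) ^ (0 : ℤ))
    {ε : LocalRing E v} (hεσ : conjLocal E c v ε = -ε) (hεint : ∀ w : PlacesOver E v, Valued.v (ε w) ≤ 1)
    (hε : ∀ w : PlacesOver E v, Valued.v (toPlace v w π) ^ (0 : ℤ) ≤ Valued.v ((2 * ε) w))
    (h2 : ∀ w : PlacesOver E v, Valued.v (toPlace v w π) ^ (0 : ℤ) ≤ Valued.v ((2 : LocalRing E v) w))
    {ψ : AddChar (v.adicCompletion F) Circle} (hdψ : ψ.HasConductorExp 0)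
    {β βinv : Matrix (Fin 2) (Fin 2) (LocalRing E v)} (hβs : (β.map (conjLocal E c v))ᵀ * gramS F E v 2 T₂ + gramS F E v 2 T₂ * β = 0)
    (hββ : β * βinv = 1) (hβ0 : ∀ i j (w : PlacesOver E v), Valued.v (β i j w) ≤ Valued.v (toPlace v w π) ^ (0 : ℤ))
    (hβinv0 : ∀ i j (w : PlacesOver E v), Valued.v (βinv i j w) ≤ Valued.v (toPlace v w π) ^ (0 : ℤ))
    {k : ℕ} (hk : 2 ≤ k) {X : Matrix (Fin 2) (Fin 2) (LocalRing E v)}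
    (hXs : (X.map (conjLocal E c v))ᵀ * gramS F E v 2 T₂ + gramS F E v 2 T₂ * X = 0)
    (hXb : ∀ i j (w : PlacesOver E v), Valued.v (X i j w) ≤ Valued.v (toPlace v w π) ^ (-(k : ℤ)))
    (hXd : ∀ w : PlacesOver E v, Valued.v (X.det w) ≤ Valued.v (toPlace v w π) ^ (-(k : ℤ) - 1)) :
    ∃ Z : Matrix (Fin 2) (Fin 2) (LocalRing E v), (Z.map (conjLocal E c v))ᵀ * gramS F E v 2 T₂ + gramS F E v 2 T₂ * Z = 0 ∧
      (∀ i j (w : PlacesOver E v), Valued.v (Z i j w) ≤ Valued.v (toPlace v w π) ^ (-1 : ℤ)) ∧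
      (∀ w : PlacesOver E v, Valued.v (Matrix.trace (X.adjugate * Z) w) ≤ Valued.v (toPlace v w π) ^ (-(k : ℤ))) ∧
      ψ (-τ (Matrix.trace (β * Z))) ≠ 1 := by
  by_contra hall
  push Not at hall
  have hπ0 : ∀ w : PlacesOver E v, Valued.v (toPlace v w π) ≠ 0 := fun w => valued_toPlace_uniformizer_ne_zero F E v hπ w
  have hπ1 : ∀ w : PlacesOver E v, Valued.v (toPlace v w π) ≤ 1 := fun w => valued_toPlace_uniformizer_le_one F E v hπ w
  -- `W := ι(ϖ^k) · adj X ∈ S ∩ ball 0`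
  set W : Matrix (Fin 2) (Fin 2) (LocalRing E v) := toLocalRing E v (π ^ k) • X.adjugate with hWdef
  have hWs := smul_skew F E c v (π ^ k) (adjugate_skew F E c v hT₂ hT₂d hXs)
  have hπk : π ^ k ∈ primePowBall (v.adicCompletion F) (k : ℤ) := by
    rw [mem_primePowBall_iff_le_zpow F v hπ, map_pow, zpow_natCast]
  have hW0 : ∀ i j (w : PlacesOver E v), Valued.v (W i j w) ≤ Valued.v (toPlace v w π) ^ (0 : ℤ) := by
    have h1 := mball_smul F E v hπ hπk (mball_adjugate F E v hXb)
    rwa [show (k : ℤ) + -(k : ℤ) = 0 by ring] at h1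
  -- (H'): on `S ∩ ball 0`, `τ tr(WY) ∈ 𝔭 ⇒ τ tr(βY) ∈ 𝔭`
  have H : ∀ Y : Matrix (Fin 2) (Fin 2) (LocalRing E v), (Y.map (conjLocal E c v))ᵀ * gramS F E v 2 T₂ + gramS F E v 2 T₂ * Y = 0 →
      (∀ i j (w : PlacesOver E v), Valued.v (Y i j w) ≤ Valued.v (toPlace v w π) ^ (0 : ℤ)) →
        τ (Matrix.trace (W * Y)) ∈ primePowBall (v.adicCompletion F) 1 → τ (Matrix.trace (β * Y)) ∈ primePowBall (v.adicCompletion F) 1 := by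
    intro Y hYs hYb hWY
    by_contra hβY
    obtain ⟨x₀, hx₀, hne⟩ := exists_mem_primePowBall_addChar_mul_ne_one hdψ (n := -1) (y := τ (Matrix.trace (β * Y)))
      (by rwa [show (0 : ℤ) - -1 = 1 by norm_num])
    have hZs := smul_skew F E c v (-x₀) hYs
    have hZb : ∀ i j (w : PlacesOver E v), Valued.v ((toLocalRing E v (-x₀) • Y) i j w) ≤ Valued.v (toPlace v w π) ^ (-1 : ℤ) := by
      have h1 := mball_smul F E v hπ (neg_mem_primePowBall hx₀) hYb
      rwa [add_zero] at h1
    -- `tr(adj X · Y) ∈ ball(1 − k)` from `τ tr(WY) ∈ 𝔭` (`tr(WY)` is `σ`-fixed, `|2|_w = 1`)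
    have hr : ∀ w : PlacesOver E v, Valued.v (Matrix.trace (X.adjugate * Y) w) ≤ Valued.v (toPlace v w π) ^ (1 - (k : ℤ)) := by
      have hWYeq : Matrix.trace (W * Y) = toLocalRing E v (π ^ k) * Matrix.trace (X.adjugate * Y) := by
        rw [hWdef, Matrix.smul_mul, Matrix.trace_smul, smul_eq_mul]
      have h2r : toLocalRing E v (τ (Matrix.trace (W * Y))) = 2 * Matrix.trace (W * Y) := by
        rw [hτ, conj_trace_mul_of_skew F E c v hT₂ hT₂d hWs hYs, two_mul]
      intro w
      have h1 := ball_toLocalRing_of_mem_primePowBall F E v hπ hWY w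
      have h2w : Valued.v ((2 : LocalRing E v) w) = 1 := by
        refine le_antisymm ?_ (by simpa using h2 w)
        rw [Pi.ofNat_apply, show (2 : w.1.adicCompletion E) = 1 + 1 by norm_num]
        exact (Valuation.map_add _ _ _).trans (by rw [map_one, max_self])
      rw [h2r, Pi.mul_apply, map_mul, h2w, one_mul, hWYeq, Pi.mul_apply, map_mul, toLocalRing_apply, map_pow, map_pow] at h1
      calc Valued.v (Matrix.trace (X.adjugate * Y) w)
          = (Valued.v (toPlace v w π) ^ k)⁻¹ * (Valued.v (toPlace v w π) ^ k * Valued.v (Matrix.trace (X.adjugate * Y) w)) := by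
            rw [inv_mul_cancel_left₀ (pow_ne_zero _ (hπ0 w))]
        _ ≤ (Valued.v (toPlace v w π) ^ k)⁻¹ * Valued.v (toPlace v w π) ^ (1 : ℤ) := mul_le_mul' le_rfl h1
        _ = Valued.v (toPlace v w π) ^ (1 - (k : ℤ)) := by
            rw [← zpow_natCast, ← _root_.zpow_neg, ← zpow_add₀ (hπ0 w), neg_add_eq_sub]
    have htrZ : ∀ w : PlacesOver E v, Valued.v (Matrix.trace (X.adjugate * (toLocalRing E v (-x₀) • Y)) w) ≤ Valued.v (toPlace v w π) ^ (-(k : ℤ)) := by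
      intro w
      rw [Matrix.mul_smul, Matrix.trace_smul, smul_eq_mul, Pi.mul_apply, map_mul]
      have hx : Valued.v (toLocalRing E v (-x₀) w) ≤ Valued.v (toPlace v w π) ^ (-1 : ℤ) :=
        ball_toLocalRing_of_mem_primePowBall F E v hπ (neg_mem_primePowBall hx₀) w
      calc Valued.v (toLocalRing E v (-x₀) w) * Valued.v (Matrix.trace (X.adjugate * Y) w)
          ≤ Valued.v (toPlace v w π) ^ (-1 : ℤ) * Valued.v (toPlace v w π) ^ (1 - (k : ℤ)) := mul_le_mul' hx (hr w)
        _ = Valued.v (toPlace v w π) ^ (-(k : ℤ)) := by rw [← zpow_add₀ (hπ0 w)]; ring_nf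
    have h := hall _ hZs hZb htrZ
    rw [tau_trace_mul_smul F E v hτs, neg_mul, neg_neg] at h
    exact hne h
  -- elimination (§2) and perfectness (§1): `t := β − ι(λ)W ∈ ball 1`
  obtain ⟨lam, hlam, hsub⟩ := exists_scalar_tau_trace_sub_mem F E c v hπ hτ hτadd hτs hW0 hβ0 H
  have hts := sub_skew F E c v hβs (smul_skew F E c v lam hWs)
  have ht1 := mball_one_of_forall_tau_trace_mem F E c hcδ hδ v hπ hT₂ hT₂d hτ hτadd h2F hTb hTib hεσ hεint hε h2 hβs hββ hβ0 hβinv0 hts hsub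
  -- `det β ∈ 𝔭`
  have hlam0 : lam ∈ primePowBall (v.adicCompletion F) 0 := by rw [mem_primePowBall_iff_le_zpow F v hπ, zpow_zero]; exact hlam
  have hA0 : ∀ i j (w : PlacesOver E v), Valued.v ((toLocalRing E v lam • W) i j w) ≤ Valued.v (toPlace v w π) ^ (0 : ℤ) := by
    have h1 := mball_smul F E v hπ hlam0 hW0
    rwa [add_zero] at h1
  have hdetA : ∀ w : PlacesOver E v, Valued.v ((toLocalRing E v lam • W).det w) ≤ Valued.v (toPlace v w π) ^ (1 : ℤ) := by
    intro w
    rw [hWdef, smul_smul, Matrix.det_smul, Matrix.det_adjugate, Fintype.card_fin, pow_one, ← map_mul, Pi.mul_apply, Pi.pow_apply, map_mul,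
      map_pow, toLocalRing_apply, map_mul, map_mul, map_pow, map_pow]
    have hl : Valued.v (toPlace v w lam) ≤ 1 := by
      have h1 := ball_toLocalRing_of_mem_primePowBall F E v hπ hlam0 w
      rwa [toLocalRing_apply, zpow_zero] at h1
    calc (Valued.v (toPlace v w lam) * Valued.v (toPlace v w π) ^ k) ^ 2 * Valued.v (X.det w)
        ≤ (1 * Valued.v (toPlace v w π) ^ k) ^ 2 * Valued.v (toPlace v w π) ^ (-(k : ℤ) - 1) :=
          mul_le_mul' (pow_le_pow_left₀ zero_le (mul_le_mul' hl le_rfl) 2) (hXd w)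
      _ = Valued.v (toPlace v w π) ^ ((k : ℤ) - 1) := by
          rw [one_mul, ← pow_mul, ← zpow_natCast, ← zpow_add₀ (hπ0 w)]
          congr 1
          push_cast
          ring
      _ ≤ Valued.v (toPlace v w π) ^ (1 : ℤ) := zpow_le_zpow_right_of_le_one₀ (zero_lt_iff.2 (hπ0 w)) (hπ1 w) (by omega)
  have htr : ∀ w : PlacesOver E v, Valued.v (Matrix.trace ((toLocalRing E v lam • W).adjugate * (β - toLocalRing E v lam • W)) w) ≤
      Valued.v (toPlace v w π) ^ (1 : ℤ) := by
    have h1 := ball_trace F E v (mball_mul F E v hπ (mball_adjugate F E v hA0) ht1)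
    rwa [zero_add] at h1
  have hdett : ∀ w : PlacesOver E v, Valued.v ((β - toLocalRing E v lam • W).det w) ≤ Valued.v (toPlace v w π) ^ (1 : ℤ) :=
    ball_antitone F E v hπ (show (1 : ℤ) ≤ 1 + 1 by norm_num) (det_mem_ball_two F E v hπ ht1)
  have hdetβ : ∀ w : PlacesOver E v, Valued.v (β.det w) ≤ Valued.v (toPlace v w π) ^ (1 : ℤ) := by
    have hβeq : β = toLocalRing E v lam • W + (β - toLocalRing E v lam • W) := by rw [add_sub_cancel]
    have hd : β.det = (toLocalRing E v lam • W).det + Matrix.trace ((toLocalRing E v lam • W).adjugate * (β - toLocalRing E v lam • W)) +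
        (β - toLocalRing E v lam • W).det := by
      conv_lhs => rw [hβeq]
      exact det_add_fin_two _ _
    rw [hd]
    exact ball_add F E v (ball_add F E v hdetA htr) hdett
  -- but `det β` is a unit: `det β · det β⁻ = 1`, `det β⁻` integral
  obtain ⟨w⟩ := (inferInstance : Nonempty (PlacesOver E v))
  have hprod : β.det w * βinv.det w = 1 := by rw [← Pi.mul_apply, ← Matrix.det_mul, hββ, Matrix.det_one, Pi.one_apply]
  have hinv : Valued.v (βinv.det w) ≤ 1 := by
    have h1 := det_mem_ball_two F E v hπ hβinv0 w
    rwa [add_zero, zpow_zero] at h1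
  have hlt : Valued.v (toPlace v w π) ^ (1 : ℤ) < 1 := by
    rw [zpow_one]
    exact lt_of_le_of_lt (valued_toPlace_uniformizer_le F E v hπ w) (by rw [← WithZero.exp_zero, WithZero.exp_lt_exp]; norm_num)
  have h1 : (1 : WithZero (Multiplicative ℤ)) ≤ Valued.v (toPlace v w π) ^ (1 : ℤ) := by
    calc (1 : WithZero (Multiplicative ℤ)) = Valued.v (β.det w) * Valued.v (βinv.det w) := by rw [← map_mul, hprod, map_one]
      _ ≤ Valued.v (toPlace v w π) ^ (1 : ℤ) * 1 := mul_le_mul' (hdetβ w) hinv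
      _ = Valued.v (toPlace v w π) ^ (1 : ℤ) := mul_one _
  exact absurd (lt_of_le_of_lt h1 hlt) (lt_irrefl _)

end RankTwo

end Summit.HodgeConjecture.HodgeConjecture.Cruxes.HLiu418.K2LiuSkewPairingPerfect

end
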